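import Literature.NumberTheory.QuadraticForms.IsotropicRankFive
import Literature.NumberTheory.QuadraticForms.HasseInvariantFrames
import Literature.NumberTheory.QuadraticForms.DiagonalFormIsotropyAlgebra
import HarnessLib

/-!
# Serre's Theorem 6: isotropy and represented values of quadratic forms over a regular Hilbert field

Topic `NumberTheory/QuadraticForms`; namespace `Literature.NumberTheory.QuadraticForms`. Everything here
is proved; pure field algebra on top of `HilbertSymbolRegular.lean` and `IsotropicRankFive.lean`.

Serre, *A Course in Arithmetic*, Ch. IV §2.2: over `k = ℚ_p` let `f ∼ a₁X₁² + ⋯ + aₙXₙ²` be a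
nondegenerate quadratic form with invariants `d = a₁ ⋯ aₙ ∈ k^*/k^{*2}` and `ε = ∏_{i<j} (aᵢ, aⱼ)`
(§2.1). **Theorem 6**: `f` represents `0` iff (i) `n = 2` and `d = -1`; (ii) `n = 3` and
`(-1, -d) = ε`; (iii) `n = 4` and either `d ≠ 1`, or `d = 1` and `ε = (-1, -1)`; (iv) `n ≥ 5`.
**Corollary**: `f` represents `a ∈ k^*/k^{*2}` iff (i) `n = 1` and `a = d`; (ii) `n = 2` and
`(a, -d) = ε`; (iii) `n = 3` and either `a ≠ -d`, or `a = -d` and `(-1, -d) = ε`; (iv) `n ≥ 4` — "we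
know (cf. n° 1.6) that `f_a = f ∸ aZ²` represents `0` if and only if `f` represents `a`", and
`d(f_a) = -a d`, `ε(f_a) = (-a, d) ε`.

As Serre notes in §2.4, parts (i)–(iii) of the theorem and of the corollary "use only the nondegeneracy of
the Hilbert symbol"; we prove them over any field `F` whose Hilbert symbol is bilinear and nondegenerate
(`IsRegularHilbertField F`, `HilbertSymbolRegular.lean`; e.g. `ℚ_p` by `isRegularHilbertField_padic`,
and `ℝ`), and part (iv) under the extra hypothesis of `IsotropicRankFive.lean` that `F` has three
non-squares `b, c, bc` (true for `ℚ_p`, `padic_exists_three_nonsquares`; false for `ℝ`). Forms are the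
diagonal forms `⟨c₀, …, c_{n-1}⟩ = ∑ cᵢ Xᵢ²` of the tree (`DiagIsotropic`, `DiagonalFormIsotropy.lean`;
"`f` represents `t`" is `∃ x, ∑ cᵢ xᵢ² = t`), `d = ∏ cᵢ`, and `ε = hasseProd (hilbertSymbol F) c`
(`HasseInvariantFrames.lean`).

* `IsRegularHilbertField.isHasseSymbol` — the Hilbert symbol of a regular Hilbert field is an abstract
  Hasse symbol (`IsHasseSymbol`: symmetric, bimultiplicative, `±1`-valued, invariant on binary forms —
  the last from Cor. (ii), `exists_binary_eq_iff`), so that `HasseInvariantFramesWitt.lean` (Thm 5)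
  applies to it;
* `hasseProd_cons`, `hasseProd_eq_last_mul`, `hasseProd_fin_three` — `ε(⟨q⟩ ⊥ g) = (q, d(g)) ε(g)`;
* `diagIsotropic_cons_neg_iff` — `⟨-t⟩ ⊥ f` is isotropic iff `f` represents `t` (§1.6 Cor. 1 to
  Prop. 3 with Prop. 3'; for `t = 0` both sides hold trivially);
* Theorem 6: (i) is `diagIsotropic_two_iff_isSquare` (`DiagonalFormIsotropyAlgebra.lean`, any field);
  (ii) `IsRegularHilbertField.diagIsotropic_three_iff`; (iii) `IsRegularHilbertField.diagIsotropic_four_iff`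
  (the case `d ≠ 1` is `exists_isotropic_of_rank_four` of `IsotropicRankFive.lean`; the case `d = 1` is
  reduced to (ii) for `⟨c₀, c₁, c₂⟩` by O'Meara 42:12, `diagIsotropic_three_of_four_of_isSquare_disc`);
  (iv) `IsRegularHilbertField.diagIsotropic_of_five_le`;
* Corollary: `exists_sum_one_eq_iff` (any field), `IsRegularHilbertField.exists_sum_two_eq_iff`,
  `IsRegularHilbertField.exists_sum_three_eq_iff`, `IsRegularHilbertField.exists_sum_eq_of_four_le`;
* `IsRegularHilbertField.exists_sum_eq_iff_of_invariants(_of_le_three)` — two forms of the same rank with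
  the same invariants `d`, `ε` represent the same elements (the step of the proof of §2.3 Thm 7).

## References

* J.-P. Serre, *A Course in Arithmetic*, GTM 7, Springer 1973, Ch. IV §1.6 (Prop. 3', Cor. 1 to Prop. 3),
  §2.1 (Thm 5), §2.2 (Thm 6 and Corollary), §2.4 [corpus:book:serre1973-course-arithmetic pp. 31–38].
  [Serre1973]
* O. T. O'Meara, *Introduction to Quadratic Forms*, Grundlehren 117, Springer 1963, §42D 42:12. [Omeara1963]
-/

namespace Literature.NumberTheory.QuadraticForms

open Finset

variable {F : Type*} [Field F]

/-! ### Sign bookkeeping -/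

/-- For `P Q = ±1`: `X·Y·P·Q = R ↔ X·Y = P·Q·R`. [folklore] -/
private theorem sign_aux₁ {X Y P Q R : ℤ} (hP : P = 1 ∨ P = -1) (hQ : Q = 1 ∨ Q = -1) :
    X * (Y * (P * Q)) = R ↔ X * Y = P * Q * R := by
  rcases hP with rfl | rfl <;> rcases hQ with rfl | rfl <;> constructor <;> intro h <;> linarith

/-- For `V = ±1`: `U·V = E ↔ V·E = U`. [folklore] -/
private theorem sign_aux₂ {U V E : ℤ} (hV : V = 1 ∨ V = -1) : U * V = E ↔ V * E = U := by
  rcases hV with rfl | rfl <;> constructor <;> intro h <;> linarith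

/-- `x c²` is a square iff `x` is, for `c ≠ 0`. [folklore] -/
private theorem isSquare_mul_sq_iff {x c : F} (hc : c ≠ 0) : IsSquare (x * c ^ 2) ↔ IsSquare x := by
  constructor
  · rintro ⟨u, hu⟩
    refine ⟨u / c, ?_⟩
    rw [div_mul_div_comm, eq_div_iff (mul_ne_zero hc hc)]
    linear_combination hu
  · rintro ⟨u, hu⟩
    exact ⟨u * c, by rw [hu]; ring⟩

/-! ### The Hilbert symbol of a regular Hilbert field is a Hasse symbol -/

/-- **The Hilbert symbol of a regular Hilbert field is an abstract Hasse symbol** (`IsHasseSymbol`,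
`HasseInvariantFrames.lean`): symmetric, bimultiplicative, `±1`-valued, and equal on isomorphic binary
forms — if `a' = a x² + b y² ≠ 0` and `a' b' = a b c²` then `(a, b) = (a', b')`. The last property is
Serre's rank-`2` case of Ch. IV §2.1 Thm 5 ("`ε(e) = 1` iff `a₁X² + a₂Y²` represents `1`, which does
not depend on `e`"); here: `⟨a, b⟩` represents `a'`, so `(a', -ab) = (a, b)` (Cor. (ii) to Thm 6,
`exists_binary_eq_iff`), and `(a', b') = (a', -ab · (-a') · (c/a')²) = (a', -ab) (a', -a') = (a', -ab)`.
[cite: Serre1973, Ch. IV §2.1 Thm 5] -/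
theorem IsRegularHilbertField.isHasseSymbol (hF : IsRegularHilbertField F) :
    IsHasseSymbol (hilbertSymbol F) where
  comm := hilbertSymbol_comm
  mul_left a a' b ha ha' hb := hF.mul_left a a' b ha ha' hb
  mul_self a b _ _ := by
    rcases hilbertSymbol_eq_one_or_eq_neg_one a b with h | h <;> simp [h]
  binary a b a' b' x y c ha hb ha' _ hc hrep hdisc := by
    haveI : NeZero (2 : F) := ⟨hF.two_ne_zero⟩
    have h1 : hilbertSymbol F a' (-(a * b)) = hilbertSymbol F a b :=
      (hF.exists_binary_eq_iff ha hb ha').1 ⟨x, y, hrep.symm⟩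
    have hb' : b' = a * b * c ^ 2 / a' := by
      rw [eq_div_iff ha']
      linear_combination hdisc
    have hb'' : a * b * c ^ 2 / a' = -(a * b) * (-a' * (c / a') ^ 2) := by
      field_simp
    rw [hb', hb'', hF.mul_right ha' (neg_ne_zero.mpr (mul_ne_zero ha hb))
      (mul_ne_zero (neg_ne_zero.mpr ha') (pow_ne_zero 2 (div_ne_zero hc ha'))),
      hilbertSymbol_mul_sq_right _ _ (div_ne_zero hc ha'), hilbertSymbol_neg_self_right ha', mul_one, h1]

/-! ### Hasse products of small families and of `⟨q⟩ ⊥ g` -/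

section HasseProd

variable {K : Type*} [Field K] {s : K → K → ℤ}

/-- **`ε(⟨q⟩ ⊥ g) = (q, d(g)) · ε(g)`**: the Hasse product of `(q, c₀, …, c_{n-1})` is
`s q (∏ cᵢ) · hasseProd s c` (Serre's `ε(e) = (a₁, a₂ ⋯ aₙ) ∏_{2 ≤ i < j} (aᵢ, aⱼ)`, proof of Ch. IV
§2.1 Thm 5; and `ε(f_a) = (-a, d) ε` of §2.2). [cite: Serre1973, Ch. IV §2.1 Thm 5] -/
theorem hasseProd_cons (hs : IsHasseSymbol s) {n : ℕ} {q : K} {c : Fin n → K} (hq : q ≠ 0)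
    (hc : ∀ i, c i ≠ 0) :
    hasseProd s (Fin.cons q c : Fin (n + 1) → K) = s q (∏ i, c i) * hasseProd s c := by
  rw [hasseProd_eq_succAbove hs.comm _ 0, hs.map_prod_right q hq c hc]
  simp only [Fin.cons_zero, Fin.succAbove_zero, Fin.cons_succ]

/-- The same split at the last index: `ε(g ⊥ ⟨q⟩) = (q, d(g)) · ε(g)` with `q = c (Fin.last n)` and
`g = ⟨c₀, …, c_{n-1}⟩`. [cite: Serre1973, Ch. IV §2.1 Thm 5] -/
theorem hasseProd_eq_last_mul (hs : IsHasseSymbol s) {n : ℕ} (c : Fin (n + 1) → K)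
    (hc : ∀ i, c i ≠ 0) :
    hasseProd s c = s (c (Fin.last n)) (∏ j : Fin n, c (Fin.castSucc j)) *
      hasseProd s (fun j : Fin n => c (Fin.castSucc j)) := by
  rw [hasseProd_eq_succAbove hs.comm c (Fin.last n),
    hs.map_prod_right _ (hc _) (fun j : Fin n => c (Fin.castSucc j)) (fun j => hc _)]
  simp only [Fin.succAbove_last]

omit [Field K] in
/-- The Hasse product of a triple: `ε(⟨c₀, c₁, c₂⟩) = (c₀, c₁)(c₀, c₂)(c₁, c₂)` (symmetric symbol; Serre's
`ε(e) = ∏_{i<j} (aᵢ, aⱼ)` for `n = 3`). [cite: Serre1973, Ch. IV §2.1] -/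
theorem hasseProd_fin_three (hcomm : ∀ a b, s a b = s b a) (c : Fin 3 → K) :
    hasseProd s c = s (c 0) (c 1) * s (c 0) (c 2) * s (c 1) (c 2) := by
  rw [hasseProd_eq_succAbove hcomm c 0, Fin.prod_univ_two, hasseProd_two]
  simp only [Fin.succAbove_zero, Fin.succ_zero_eq_one, Fin.succ_one_eq_two]

end HasseProd

/-! ### `⟨-t⟩ ⊥ f` is isotropic iff `f` represents `t` -/

/-- **`f_a = f ∸ aZ²` represents `0` iff `f` represents `a`** (Serre, Ch. IV §1.6, Cor. 1 to Prop. 3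
with Prop. 3'; quoted in §2.2 before the Corollary to Thm 6). For a nondegenerate diagonal form
`f = ⟨c₀, …, c_{n-1}⟩` over a field with `2 ≠ 0` and any `t` (Serre takes `t ∈ k^*`; for `t = 0` both
sides hold trivially): `⟨-t⟩ ⊥ f` is isotropic iff `∑ cᵢ xᵢ² = t` is soluble. (A zero `(z₀, z)` with
`z₀ ≠ 0` gives `f(z/z₀) = t`; with `z₀ = 0`, `f` is isotropic, hence universal,
`exists_sum_mul_sq_eq_of_isotropic`; conversely `(1, x)` is a zero.)
[cite: Serre1973, Ch. IV §1.6 Cor. 1 to Prop. 3] -/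
theorem diagIsotropic_cons_neg_iff (h2 : (2 : F) ≠ 0) {n : ℕ} {c : Fin n → F} (hc : ∀ i, c i ≠ 0)
    (t : F) :
    DiagIsotropic (Fin.cons (-t) c : Fin (n + 1) → F) ↔ ∃ x : Fin n → F, ∑ i, c i * x i ^ 2 = t := by
  constructor
  · rintro ⟨z, hz0, hz⟩
    rw [Fin.sum_univ_succ] at hz
    simp only [Fin.cons_zero, Fin.cons_succ] at hz
    by_cases h0 : z 0 = 0
    · have hx0 : (fun j : Fin n => z j.succ) ≠ 0 := by
        intro hzero
        apply hz0
        funext i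
        refine Fin.cases h0 (fun j => ?_) i
        exact congrFun hzero j
      refine exists_sum_mul_sq_eq_of_isotropic h2 hc hx0 ?_ t
      rw [h0] at hz
      linear_combination hz
    · refine ⟨fun j => z j.succ / z 0, ?_⟩
      have : ∑ j, c j * (z j.succ / z 0) ^ 2 = (∑ j, c j * z j.succ ^ 2) / z 0 ^ 2 := by
        rw [Finset.sum_div]
        exact Finset.sum_congr rfl fun j _ => by field_simp
      rw [this, div_eq_iff (pow_ne_zero 2 h0)]
      linear_combination hz
  · rintro ⟨x, hx⟩
    refine ⟨Fin.cons 1 x, fun h0 => by simpa using congrFun h0 0, ?_⟩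
    rw [Fin.sum_univ_succ]
    simp only [Fin.cons_zero, Fin.cons_succ, one_pow, mul_one]
    linear_combination hx

/-! ### Theorem 6 -/

namespace IsRegularHilbertField

variable (hF : IsRegularHilbertField F)
include hF

/-- **Theorem 6 (ii)** (Serre, Ch. IV §2.2): over a regular Hilbert field, a nondegenerate ternary
diagonal form `f = ⟨c₀, c₁, c₂⟩` represents `0` iff `(-1, -d) = ε`, `d = c₀c₁c₂`,
`ε = (c₀,c₁)(c₀,c₂)(c₁,c₂)`. Proof: `f` is isotropic iff `⟨c₁, c₂⟩` represents `-c₀`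
(`diagIsotropic_cons_neg_iff`), iff `(-c₀, -c₁c₂) = (c₁, c₂)` (Cor. (ii), `exists_binary_eq_iff`), and
"expanding this" by bilinearity with `(x, x) = (-1, x)` gives `(-1, -d) ε = 1`.
[cite: Serre1973, Ch. IV §2.2 Thm 6 (ii)] -/
theorem diagIsotropic_three_iff {c : Fin 3 → F} (hc : ∀ i, c i ≠ 0) :
    DiagIsotropic c ↔ hilbertSymbol F (-1) (-∏ i, c i) = hasseProd (hilbertSymbol F) c := by
  have hc' : ∀ j : Fin 2, Fin.tail c j ≠ 0 := fun j => hc j.succ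
  have key : DiagIsotropic c ↔ ∃ x : Fin 2 → F, ∑ i, Fin.tail c i * x i ^ 2 = -c 0 := by
    have h := diagIsotropic_cons_neg_iff hF.two_ne_zero hc' (-c 0)
    rwa [neg_neg, Fin.cons_self_tail] at h
  have key₂ : (∃ x : Fin 2 → F, ∑ i, Fin.tail c i * x i ^ 2 = -c 0) ↔
      ∃ x y : F, c 1 * x ^ 2 + c 2 * y ^ 2 = -c 0 := by
    constructor
    · rintro ⟨x, hx⟩
      refine ⟨x 0, x 1, ?_⟩
      rw [Fin.sum_univ_two] at hx
      simpa [Fin.tail] using hx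
    · rintro ⟨x, y, h⟩
      refine ⟨![x, y], ?_⟩
      rw [Fin.sum_univ_two]
      simpa [Fin.tail] using h
  rw [key, key₂, hF.exists_binary_eq_iff (hc 1) (hc 2) (neg_ne_zero.mpr (hc 0)),
    hasseProd_fin_three hilbertSymbol_comm c, Fin.prod_univ_three]
  -- symbol algebra: `(-c₀, -c₁c₂) = (-1,-c₁c₂)(c₀,-1)(c₀,c₁)(c₀,c₂)`, `(-1,-c₀c₁c₂) = (-1,-c₁c₂)(c₀,-1)`
  have hm1 : (-1 : F) ≠ 0 := neg_ne_zero.mpr one_ne_zero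
  have h12 : c 1 * c 2 ≠ 0 := mul_ne_zero (hc 1) (hc 2)
  have e1 : hilbertSymbol F (-c 0) (-(c 1 * c 2)) =
      hilbertSymbol F (-1) (-(c 1 * c 2)) * hilbertSymbol F (c 0) (-(c 1 * c 2)) := by
    rw [neg_eq_neg_one_mul (c 0), hF.mul_left (-1) (c 0) _ hm1 (hc 0) (neg_ne_zero.mpr h12)]
  have e2 : hilbertSymbol F (c 0) (-(c 1 * c 2)) =
      hilbertSymbol F (c 0) (-1) * (hilbertSymbol F (c 0) (c 1) * hilbertSymbol F (c 0) (c 2)) := by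
    rw [neg_eq_neg_one_mul (c 1 * c 2), hF.mul_right (hc 0) hm1 h12, hF.mul_right (hc 0) (hc 1) (hc 2)]
  have e3 : hilbertSymbol F (-1) (-(c 0 * c 1 * c 2)) =
      hilbertSymbol F (-1) (-(c 1 * c 2)) * hilbertSymbol F (c 0) (-1) := by
    rw [show -(c 0 * c 1 * c 2) = -(c 1 * c 2) * c 0 by ring,
      hF.mul_right hm1 (neg_ne_zero.mpr h12) (hc 0), hilbertSymbol_comm (-1) (c 0)]
  rw [e1, e2, e3]
  exact sign_aux₁ (hilbertSymbol_eq_one_or_eq_neg_one _ _) (hilbertSymbol_eq_one_or_eq_neg_one _ _)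

/-- **Theorem 6 (iii)** (Serre, Ch. IV §2.2): over a regular Hilbert field, a nondegenerate quaternary
diagonal form `f = ⟨c₀, c₁, c₂, c₃⟩` represents `0` iff either `d = c₀c₁c₂c₃` is not a square, or `d` is a
square and `ε = (-1, -1)`. The case `d ≠ 1` is `exists_isotropic_of_rank_four` (Serre's sets `A ∋ c₀`,
`B ∋ -c₂` meet by Lemma (c)). For `d = 1`: `f` is isotropic iff `⟨c₀, c₁, c₂⟩` is (O'Meara 42:12,
`diagIsotropic_three_of_four_of_isSquare_disc`: a zero with `x₃ ≠ 0` makes the ternary form represent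
`-c₃x₃² ∼ -c₀c₁c₂`, hence `0`), iff `(-1, -c₀c₁c₂) = ε(⟨c₀,c₁,c₂⟩)` by (ii); and since `c₃ ∼ c₀c₁c₂`,
`ε = ε(⟨c₀,c₁,c₂⟩) · (c₃, c₀c₁c₂) = ε(⟨c₀,c₁,c₂⟩) · (-1, c₀c₁c₂)` (`(x, x) = (-1, x)`), which turns the
condition into `ε = (-1, -1)` — Serre's computation `ε = (a₁,a₂)(a₃,a₄)(-1, a₃a₄)`.
[cite: Serre1973, Ch. IV §2.2 Thm 6 (iii)] -/
theorem diagIsotropic_four_iff {c : Fin 4 → F} (hc : ∀ i, c i ≠ 0) :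
    DiagIsotropic c ↔
      ¬ IsSquare (∏ i, c i) ∨ hasseProd (hilbertSymbol F) c = hilbertSymbol F (-1) (-1) := by
  haveI : NeZero (2 : F) := ⟨hF.two_ne_zero⟩
  by_cases hd : IsSquare (∏ i, c i)
  · -- `d = 1`
    rw [or_iff_right (not_not_intro hd)]
    obtain ⟨s, hs⟩ := hd
    have hs4 : c 0 * c 1 * c 2 * c 3 = s ^ 2 := by rw [← Fin.prod_univ_four, hs, sq]
    have iff3 : DiagIsotropic c ↔ DiagIsotropic (fun i : Fin 3 => c i.castSucc) :=
      ⟨diagIsotropic_three_of_four_of_isSquare_disc hc hs4,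
        fun h => DiagIsotropic.of_comp_injective Fin.castSucc (Fin.castSucc_injective 3) h⟩
    rw [iff3, hF.diagIsotropic_three_iff (fun i => hc _),
      hasseProd_eq_last_mul hF.isHasseSymbol c hc]
    -- `T = c₀c₁c₂`, `c₃ = T (s/T)²`
    set T : F := ∏ j : Fin 3, c (Fin.castSucc j) with hTdef
    have hT : T ≠ 0 := prod_ne_zero_iff.mpr fun j _ => hc _
    have hTs : T * c (Fin.last 3) = s * s := by rw [← hs, Fin.prod_univ_castSucc]
    have hs0 : s ≠ 0 := by
      intro h0
      rw [h0, mul_zero] at hTs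
      exact mul_ne_zero hT (hc _) hTs
    have hc3 : c (Fin.last 3) = T * (s / T) ^ 2 := by
      rw [div_pow, mul_div_assoc', eq_div_iff (pow_ne_zero 2 hT)]
      linear_combination T * hTs
    have hm1 : (-1 : F) ≠ 0 := neg_ne_zero.mpr one_ne_zero
    have e1 : hilbertSymbol F (c (Fin.last 3)) T = hilbertSymbol F T (-1) := by
      rw [hc3, hilbertSymbol_mul_sq_left _ _ (div_ne_zero hs0 hT), hF.self_right hT]
    have e2 : hilbertSymbol F (-1) (-T) = hilbertSymbol F (-1) (-1) * hilbertSymbol F T (-1) := by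
      rw [neg_eq_neg_one_mul T, hF.mul_right hm1 hm1 hT, hilbertSymbol_comm (-1) T]
    rw [e1, e2]
    exact sign_aux₂ (hilbertSymbol_eq_one_or_eq_neg_one _ _)
  · -- `d ≠ 1`
    rw [iff_true_intro (Or.inl hd : ¬ IsSquare (∏ i, c i) ∨ _), iff_true]
    exact exists_isotropic_of_rank_four hF hc (by rwa [← Fin.prod_univ_four])

/-- **Theorem 6 (iv)** (Serre, Ch. IV §2.2: "all forms in at least 5 variables represent 0") for
diagonal forms over a regular Hilbert field with three non-squares `b, c, bc` (as `ℚ_p`): every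
`⟨c₀, …, c_{n-1}⟩` with `n ≥ 5`, `cᵢ ≠ 0`, is isotropic (`exists_isotropic_of_rank_five` on the first five
variables). [cite: Serre1973, Ch. IV §2.2 Thm 6 (iv)] -/
theorem diagIsotropic_of_five_le (hC : ∃ b c : F, ¬ IsSquare b ∧ ¬ IsSquare c ∧ ¬ IsSquare (b * c))
    {n : ℕ} (hn : 5 ≤ n) {c : Fin n → F} (hc : ∀ i, c i ≠ 0) : DiagIsotropic c :=
  DiagIsotropic.of_comp_injective (Fin.castLE hn) (Fin.castLE_injective hn)
    (exists_isotropic_of_rank_five hF hC (a := c ∘ Fin.castLE hn) fun _ => hc _)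

end IsRegularHilbertField

/-! ### Corollary: the values represented by a form -/

/-- **Corollary to Theorem 6, (i)** (Serre, Ch. IV §2.2: "`n = 1` and `a = d`"), over any field: for
`c₀ ≠ 0`, `c₀x² = t` is soluble iff `t c₀` is a square (for `t ≠ 0`: iff `t = d` in `F^*/F^{*2}`).
[cite: Serre1973, Ch. IV §2.2 Cor. to Thm 6 (i)] -/
theorem exists_sum_one_eq_iff {c : Fin 1 → F} (hc : c 0 ≠ 0) (t : F) :
    (∃ x : Fin 1 → F, ∑ i, c i * x i ^ 2 = t) ↔ IsSquare (t * c 0) := by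
  constructor
  · rintro ⟨x, hx⟩
    rw [Fin.sum_univ_one] at hx
    exact ⟨c 0 * x 0, by rw [← hx]; ring⟩
  · rintro ⟨r, hr⟩
    refine ⟨fun _ => r / c 0, ?_⟩
    rw [Fin.sum_univ_one, div_pow, mul_div_assoc', div_eq_iff (pow_ne_zero 2 hc)]
    linear_combination (-(c 0)) * hr

namespace IsRegularHilbertField

variable (hF : IsRegularHilbertField F)
include hF

/-- **Corollary to Theorem 6, (ii)** (Serre, Ch. IV §2.2: "`n = 2` and `(a, -d) = ε`"): over a regular
Hilbert field, `⟨c₀, c₁⟩` represents `t ≠ 0` iff `(t, -c₀c₁) = (c₀, c₁)` — the tree's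
`exists_binary_eq_iff` in the `Fin`-indexed vocabulary. [cite: Serre1973, Ch. IV §2.2 Cor. to Thm 6 (ii)] -/
theorem exists_sum_two_eq_iff {c : Fin 2 → F} (hc : ∀ i, c i ≠ 0) {t : F} (ht : t ≠ 0) :
    (∃ x : Fin 2 → F, ∑ i, c i * x i ^ 2 = t) ↔
      hilbertSymbol F t (-∏ i, c i) = hasseProd (hilbertSymbol F) c := by
  rw [hasseProd_two, Fin.prod_univ_two, ← hF.exists_binary_eq_iff (hc 0) (hc 1) ht]
  constructor
  · rintro ⟨x, hx⟩
    exact ⟨x 0, x 1, by rw [Fin.sum_univ_two] at hx; exact hx⟩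
  · rintro ⟨x, y, h⟩
    exact ⟨![x, y], by rw [Fin.sum_univ_two]; simpa using h⟩

/-- **Corollary to Theorem 6, (iii)** (Serre, Ch. IV §2.2: "`n = 3` and either `a ≠ -d` or `a = -d` and
`(-1, -d) = ε`"): over a regular Hilbert field, `⟨c₀, c₁, c₂⟩` represents `t ≠ 0` iff either `-d t` is not
a square (`d = c₀c₁c₂`), or it is and `(-1, -d) = ε`. By `diagIsotropic_cons_neg_iff` and Thm 6 (iii) for
`f_t = ⟨-t⟩ ⊥ f`, whose invariants are `d(f_t) = -t d` and `ε(f_t) = (-t, d) ε` (`hasseProd_cons`); when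
`t ∼ -d`, `(-t, d) = (d, d) = (-1, d)` turns `ε(f_t) = (-1, -1)` into `(-1, -d) = ε`.
[cite: Serre1973, Ch. IV §2.2 Cor. to Thm 6 (iii)] -/
theorem exists_sum_three_eq_iff {c : Fin 3 → F} (hc : ∀ i, c i ≠ 0) {t : F} (ht : t ≠ 0) :
    (∃ x : Fin 3 → F, ∑ i, c i * x i ^ 2 = t) ↔
      ¬ IsSquare (-(∏ i, c i) * t) ∨
        hilbertSymbol F (-1) (-∏ i, c i) = hasseProd (hilbertSymbol F) c := by
  have hc' : ∀ i, (Fin.cons (-t) c : Fin 4 → F) i ≠ 0 := fun i => by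
    refine Fin.cases ?_ (fun j => ?_) i
    · simpa using ht
    · simpa using hc j
  rw [← diagIsotropic_cons_neg_iff hF.two_ne_zero hc t, hF.diagIsotropic_four_iff hc',
    hasseProd_cons hF.isHasseSymbol (neg_ne_zero.mpr ht) hc, Fin.prod_univ_succ]
  simp only [Fin.cons_zero, Fin.cons_succ]
  set d : F := ∏ i, c i with hddef
  have hd : d ≠ 0 := prod_ne_zero_iff.mpr fun i _ => hc i
  rw [show -t * d = -d * t by ring]
  by_cases hsq : IsSquare (-d * t)
  · rw [or_iff_right (not_not_intro hsq), or_iff_right (not_not_intro hsq)]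
    obtain ⟨r, hr⟩ := hsq
    -- `-t = d (r/d)²`
    have hr0 : r ≠ 0 := by
      intro h0
      rw [h0, mul_zero] at hr
      exact mul_ne_zero (neg_ne_zero.mpr hd) ht hr
    have ht' : -t = d * (r / d) ^ 2 := by
      rw [div_pow, mul_div_assoc', eq_div_iff (pow_ne_zero 2 hd)]
      linear_combination d * hr
    have hm1 : (-1 : F) ≠ 0 := neg_ne_zero.mpr one_ne_zero
    have e1 : hilbertSymbol F (-t) d = hilbertSymbol F d (-1) := by
      rw [ht', hilbertSymbol_mul_sq_left _ _ (div_ne_zero hr0 hd), hF.self_right hd]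
    have e2 : hilbertSymbol F (-1) (-d) = hilbertSymbol F (-1) (-1) * hilbertSymbol F d (-1) := by
      rw [neg_eq_neg_one_mul d, hF.mul_right hm1 hm1 hd, hilbertSymbol_comm (-1) d]
    rw [e1, e2]
    exact (sign_aux₂ (hilbertSymbol_eq_one_or_eq_neg_one _ _)).symm
  · simp only [hsq, not_false_eq_true, true_or]

/-- **Corollary to Theorem 6, (iv)** (Serre, Ch. IV §2.2: "`n ≥ 4`": every `a ∈ k^*` is represented):
over a regular Hilbert field with three non-squares `b, c, bc`, a nondegenerate diagonal form in `n ≥ 4`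
variables represents every element (`t = 0` trivially by `x = 0`; for `t ≠ 0`, `⟨-t⟩ ⊥ f` has rank `≥ 5`
and is isotropic, Thm 6 (iv)). [cite: Serre1973, Ch. IV §2.2 Cor. to Thm 6 (iv)] -/
theorem exists_sum_eq_of_four_le (hC : ∃ b c : F, ¬ IsSquare b ∧ ¬ IsSquare c ∧ ¬ IsSquare (b * c))
    {n : ℕ} (hn : 4 ≤ n) {c : Fin n → F} (hc : ∀ i, c i ≠ 0) (t : F) :
    ∃ x : Fin n → F, ∑ i, c i * x i ^ 2 = t := by
  by_cases ht : t = 0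
  · exact ⟨0, by simp [ht]⟩
  have hc' : ∀ i, (Fin.cons (-t) c : Fin (n + 1) → F) i ≠ 0 := fun i => by
    refine Fin.cases ?_ (fun j => ?_) i
    · simpa using ht
    · simpa using hc j
  exact (diagIsotropic_cons_neg_iff hF.two_ne_zero hc t).1
    (hF.diagIsotropic_of_five_le hC (by omega) hc')

/-! ### Forms with the same invariants represent the same elements -/

/-- **Two forms of the same rank `n ≤ 3` with the same invariants `d`, `ε` represent the same non-zero
elements** (Serre, Ch. IV §2.3, proof of Thm 7: "Corollary to theorem 6 shows that `f` and `g` represent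
the same elements of `k^*/k^{*2}`"), over any regular Hilbert field (no hypothesis on the number of square
classes: parts (i)–(iii) of the Corollary only). Same discriminant is `IsSquare (d(a) · d(b))`.
[cite: Serre1973, Ch. IV §2.3 Thm 7 (proof)] -/
theorem exists_sum_eq_iff_of_invariants_of_le_three {n : ℕ} (hn : n ≤ 3) {a b : Fin n → F}
    (ha : ∀ i, a i ≠ 0) (hb : ∀ i, b i ≠ 0) (hd : IsSquare ((∏ i, a i) * ∏ i, b i))
    (hε : hasseProd (hilbertSymbol F) a = hasseProd (hilbertSymbol F) b) {t : F} (ht : t ≠ 0) :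
    (∃ x : Fin n → F, ∑ i, a i * x i ^ 2 = t) ↔ ∃ x : Fin n → F, ∑ i, b i * x i ^ 2 = t := by
  have hda : (∏ i, a i) ≠ 0 := prod_ne_zero_iff.mpr fun i _ => ha i
  have hdb : (∏ i, b i) ≠ 0 := prod_ne_zero_iff.mpr fun i _ => hb i
  obtain ⟨r, hr⟩ := hd
  have hr0 : r ≠ 0 := by
    intro h0
    rw [h0, mul_zero] at hr
    exact mul_ne_zero hda hdb hr
  -- `d(b) = d(a) · (r / d(a))²`
  have hdb' : (∏ i, b i) = (∏ i, a i) * (r / ∏ i, a i) ^ 2 := by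
    rw [div_pow, mul_div_assoc', eq_div_iff (pow_ne_zero 2 hda)]
    linear_combination (∏ i, a i) * hr
  rcases (by omega : n = 0 ∨ n = 1 ∨ n = 2 ∨ n = 3) with rfl | rfl | rfl | rfl
  · simp only [univ_eq_empty, sum_empty]
  · rw [exists_sum_one_eq_iff (ha 0) t, exists_sum_one_eq_iff (hb 0) t]
    rw [Fin.prod_univ_one, Fin.prod_univ_one] at hdb'
    rw [hdb', ← mul_assoc, isSquare_mul_sq_iff (div_ne_zero hr0 (ha 0))]
  · rw [hF.exists_sum_two_eq_iff ha ht, hF.exists_sum_two_eq_iff hb ht, hε, hdb', neg_mul_eq_neg_mul,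
      hilbertSymbol_mul_sq_right _ _ (div_ne_zero hr0 hda)]
  · rw [hF.exists_sum_three_eq_iff ha ht, hF.exists_sum_three_eq_iff hb ht, hε, hdb', neg_mul_eq_neg_mul,
      hilbertSymbol_mul_sq_right _ _ (div_ne_zero hr0 hda),
      mul_right_comm (-∏ i, a i) ((r / ∏ i, a i) ^ 2) t, isSquare_mul_sq_iff (div_ne_zero hr0 hda)]

/-- **Two forms of the same rank with the same invariants `d`, `ε` represent the same non-zero elements**
(Serre, Ch. IV §2.3, proof of Thm 7), over a regular Hilbert field with three non-squares `b, c, bc` (as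
`ℚ_p`): ranks `≤ 3` by the previous theorem, ranks `≥ 4` because both forms are universal (Cor. (iv)).
[cite: Serre1973, Ch. IV §2.3 Thm 7 (proof)] -/
theorem exists_sum_eq_iff_of_invariants (hC : ∃ b c : F, ¬ IsSquare b ∧ ¬ IsSquare c ∧ ¬ IsSquare (b * c))
    {n : ℕ} {a b : Fin n → F} (ha : ∀ i, a i ≠ 0) (hb : ∀ i, b i ≠ 0)
    (hd : IsSquare ((∏ i, a i) * ∏ i, b i))
    (hε : hasseProd (hilbertSymbol F) a = hasseProd (hilbertSymbol F) b) {t : F} (ht : t ≠ 0) :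
    (∃ x : Fin n → F, ∑ i, a i * x i ^ 2 = t) ↔ ∃ x : Fin n → F, ∑ i, b i * x i ^ 2 = t := by
  by_cases hn : n ≤ 3
  · exact hF.exists_sum_eq_iff_of_invariants_of_le_three hn ha hb hd hε ht
  · exact ⟨fun _ => hF.exists_sum_eq_of_four_le hC (by omega) hb t,
      fun _ => hF.exists_sum_eq_of_four_le hC (by omega) ha t⟩

end IsRegularHilbertField

end Literature.NumberTheory.QuadraticForms
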